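import Literature.Topology.FourManifolds.FoldPushPlane
import Literature.Topology.FourManifolds.GenericMapCuspsFinite
import HarnessLib

/-!
# Pushing a fold arc of a map on a 4-manifold: the glued modification

Topic `Literature/Topology/FourManifolds` (programme of the fact
`Literature.Topology.FourManifolds.exists_isSimplifiedBrokenLefschetzFibration`, Baykur–Saeki 2017, §2.1,
§3: isotoping pieces of fold image — the first always-realisable modification of a generic
map, and the tool for putting the fold image in normal-crossing position).  Let `g : X → B`
have a fold chart `(φ, ψ)` of signature `(s₁, s₂, s₃)` (`ψ ∘ g = F₀ ∘ φ` on `φ.source`,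
`F₀ = foldSigMap`), and let `β = β₁(t)β₂(x)` be a push bump whose box
`[-r₁, r₁] × B̄(0, r₂)` lies in `φ.target`.  The **pushed map**
`g_θ = ψ⁻¹ ∘ F_θ ∘ φ` on `φ.source` (`F_θ = F₀ + β θ`, `FoldPushModel`), `g_θ = g` elsewhere,
is, for `‖θ‖` small:

* `C^∞` (`contMDiff_pushedMap`), equal to `g` off the compact set `φ⁻¹(tsupport β)`
  (`pushedMap_eq_of_notMem`);
* has the SAME critical set as `g` (`surjective_mfderiv_pushedMap_iff`);
* reads `ψ ∘ g_θ = F_θ ∘ φ` on `φ.source` (`apply_pushedMap_of_mem`), so that on the core of the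
  bump the fold image `ψ(g(q)) = (t, 0)` is translated to `(t, 0) + θ`.

(The persistence of fold charts along the pushed arc is the object of the sequel.)
Everything is proved; `pushedMap` is the only definition; no named facts (D-0026).

## References

* R. İ. Baykur, O. Saeki, *Simplifying indefinite fibrations on 4-manifolds*, arXiv:1705.11169,
  §2.1 p. 6, §3. [BaykurSaeki2017]
* M. Golubitsky, V. Guillemin, *Stable Mappings and Their Singularities*, GTM 14 (1973), Ch. III
  §4. [GolubitskyGuillemin1973]
-/

noncomputable section

set_option maxSynthPendingDepth 2

open Set Function Filter Module Metric
open scoped ContDiff Topology Manifold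

namespace Literature.Topology.FourManifolds

/-- Local notation: `𝔼 n` is the model Euclidean space `EuclideanSpace ℝ (Fin n)`. -/
local notation "𝔼 " n:arg => EuclideanSpace ℝ (Fin n)

namespace FoldPush

variable {X : Type*} [TopologicalSpace X] [ChartedSpace (𝔼 4) X]
  {B : Type*} [TopologicalSpace B] [ChartedSpace (𝔼 2) B]

/-- **The pushed map**: `ψ⁻¹ ∘ F_θ ∘ φ` on `φ.source`, `g` elsewhere. [cite: BaykurSaeki2017, §3] -/
def pushedMap (g : X → B) (φ : OpenPartialHomeomorph X (𝔼 4)) (ψ : OpenPartialHomeomorph B (𝔼 2))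
    (s₁ s₂ s₃ : ℝ) (β₁ : ContDiffBump (0 : ℝ)) (β₂ : ContDiffBump (0 : 𝔼 3)) (θ : 𝔼 2) :
    X → B := by
  classical
  exact φ.source.piecewise (fun q => ψ.symm (foldPushMap s₁ s₂ s₃ β₁ β₂ θ (φ q))) g

section Setup

variable {g : X → B} {φ : OpenPartialHomeomorph X (𝔼 4)} {ψ : OpenPartialHomeomorph B (𝔼 2)}
  {s₁ s₂ s₃ : ℝ} {β₁ : ContDiffBump (0 : ℝ)} {β₂ : ContDiffBump (0 : 𝔼 3)} {θ : 𝔼 2}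

omit [ChartedSpace (𝔼 4) X] [ChartedSpace (𝔼 2) B] in
/-- On `φ.source` the pushed map is `ψ⁻¹ ∘ F_θ ∘ φ`. [folklore] -/
theorem pushedMap_of_mem {q : X} (hq : q ∈ φ.source) :
    pushedMap g φ ψ s₁ s₂ s₃ β₁ β₂ θ q = ψ.symm (foldPushMap s₁ s₂ s₃ β₁ β₂ θ (φ q)) := by
  classical
  unfold pushedMap
  exact piecewise_eq_of_mem _ _ _ hq

omit [ChartedSpace (𝔼 4) X] [ChartedSpace (𝔼 2) B] in
/-- Off `φ.source` the pushed map is `g`. [folklore] -/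
theorem pushedMap_of_notMem {q : X} (hq : q ∉ φ.source) :
    pushedMap g φ ψ s₁ s₂ s₃ β₁ β₂ θ q = g q := by
  classical
  unfold pushedMap
  exact piecewise_eq_of_notMem _ _ _ hq

/-- The box `[-r₁, r₁] × B̄(0, r₂)` of the bump. [folklore] -/
def box (β₁ : ContDiffBump (0 : ℝ)) (β₂ : ContDiffBump (0 : 𝔼 3)) : Set (𝔼 4) :=
  unfibre '' (closedBall (0 : ℝ) β₁.rOut ×ˢ closedBall (0 : 𝔼 3) β₂.rOut)

/-- The box is compact. [folklore] -/
theorem isCompact_box (β₁ : ContDiffBump (0 : ℝ)) (β₂ : ContDiffBump (0 : 𝔼 3)) :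
    IsCompact (box β₁ β₂) :=
  ((isCompact_closedBall _ _).prod (isCompact_closedBall _ _)).image unfibre.continuous

/-- The support of the bump lies in the box. [folklore] -/
theorem tsupport_bump_subset_box (β₁ : ContDiffBump (0 : ℝ)) (β₂ : ContDiffBump (0 : 𝔼 3)) :
    tsupport (bump β₁ β₂) ⊆ box β₁ β₂ := by
  intro y hy
  obtain ⟨h0, h1⟩ := bounds_of_mem_tsupport hy
  exact ⟨(y 0, fibrePart y), ⟨by simpa using h0, by simpa using h1⟩, unfibre_fibrePart y⟩

/-- The support of the bump is compact. [folklore] -/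
theorem isCompact_tsupport_bump (β₁ : ContDiffBump (0 : ℝ)) (β₂ : ContDiffBump (0 : 𝔼 3)) :
    IsCompact (tsupport (bump β₁ β₂)) :=
  (isCompact_box β₁ β₂).of_isClosed_subset (isClosed_tsupport _) (tsupport_bump_subset_box β₁ β₂)

/-- `|β| ≤ 1`. [folklore] -/
theorem abs_bump_le_one (y : 𝔼 4) : |bump β₁ β₂ y| ≤ 1 := by
  rw [bump, abs_mul]
  have h1 : |β₁ (y 0)| ≤ 1 := by rw [abs_of_nonneg β₁.nonneg]; exact β₁.le_one
  have h2 : |β₂ (fibrePart y)| ≤ 1 := by rw [abs_of_nonneg β₂.nonneg]; exact β₂.le_one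
  calc |β₁ (y 0)| * |β₂ (fibrePart y)| ≤ 1 * 1 := by gcongr
    _ = 1 := one_mul 1

end Setup

/-! ### The margin in the target chart -/

section Margin

variable {g : X → B} {φ : OpenPartialHomeomorph X (𝔼 4)} {ψ : OpenPartialHomeomorph B (𝔼 2)}
  {s₁ s₂ s₃ : ℝ} {β₁ : ContDiffBump (0 : ℝ)} {β₂ : ContDiffBump (0 : 𝔼 3)}

omit [ChartedSpace (𝔼 4) X] [ChartedSpace (𝔼 2) B] in
/-- **Margin**: for `‖θ‖` small, `F_θ` maps `φ.target` into `ψ.target` (the fold image of the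
compact support of the bump has positive distance to the boundary of `ψ.target`). [folklore] -/
theorem exists_push_margin (hmaps : MapsTo g φ.source ψ.source)
    (hid : ∀ q ∈ φ.source, ψ (g q) = foldSigMap s₁ s₂ s₃ (φ q)) (hbox : box β₁ β₂ ⊆ φ.target) :
    ∃ δ > 0, ∀ θ : 𝔼 2, ‖θ‖ < δ → ∀ y ∈ φ.target,
      foldPushMap s₁ s₂ s₃ β₁ β₂ θ y ∈ ψ.target := by
  have hsuppt : tsupport (bump β₁ β₂) ⊆ φ.target := (tsupport_bump_subset_box β₁ β₂).trans hbox
  have hF₀t : ∀ y ∈ φ.target, foldSigMap s₁ s₂ s₃ y ∈ ψ.target := fun y hy => by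
    rw [← φ.right_inv hy, ← hid (φ.symm y) (φ.map_target hy)]
    exact ψ.map_source (hmaps (φ.map_target hy))
  set KF : Set (𝔼 2) := foldSigMap s₁ s₂ s₃ '' tsupport (bump β₁ β₂) with hKF
  have hKFc : IsCompact KF :=
    (isCompact_tsupport_bump β₁ β₂).image (contDiff_foldSigMap s₁ s₂ s₃).continuous
  have hKFt : KF ⊆ ψ.target := by
    rintro _ ⟨y, hy, rfl⟩
    exact hF₀t y (hsuppt hy)
  obtain ⟨δ, hδ, hthick⟩ := hKFc.exists_cthickening_subset_open ψ.open_target hKFt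
  refine ⟨δ, hδ, fun θ hθ y hy => ?_⟩
  by_cases hys : y ∈ tsupport (bump β₁ β₂)
  · apply hthick
    refine Metric.mem_cthickening_of_dist_le _ (foldSigMap s₁ s₂ s₃ y) _ _ ⟨y, hys, rfl⟩ ?_
    rw [foldPushMap, dist_eq_norm, add_sub_cancel_left, norm_smul, Real.norm_eq_abs]
    calc |bump β₁ β₂ y| * ‖θ‖ ≤ 1 * ‖θ‖ := by gcongr; exact abs_bump_le_one y
      _ ≤ δ := by rw [one_mul]; exact hθ.le
  · rw [foldPushMap, image_eq_zero_of_notMem_tsupport hys, zero_smul, add_zero]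
    exact hF₀t y hy

omit [ChartedSpace (𝔼 4) X] [ChartedSpace (𝔼 2) B] in
/-- The pushed map read in the charts: `ψ (g_θ (φ⁻¹ y)) = F_θ y` on `φ.target` (when `F_θ`
maps `φ.target` into `ψ.target`). [folklore] -/
theorem apply_pushedMap_symm {θ : 𝔼 2}
    (hθt : ∀ y ∈ φ.target, foldPushMap s₁ s₂ s₃ β₁ β₂ θ y ∈ ψ.target) {y : 𝔼 4}
    (hy : y ∈ φ.target) :
    ψ (pushedMap g φ ψ s₁ s₂ s₃ β₁ β₂ θ (φ.symm y)) = foldPushMap s₁ s₂ s₃ β₁ β₂ θ y := by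
  rw [pushedMap_of_mem (φ.map_target hy), φ.right_inv hy, ψ.right_inv (hθt y hy)]

omit [ChartedSpace (𝔼 4) X] [ChartedSpace (𝔼 2) B] in
/-- `ψ (g_θ q) = F_θ (φ q)` and `g_θ q ∈ ψ.source` on `φ.source`. [folklore] -/
theorem apply_pushedMap_of_mem {θ : 𝔼 2}
    (hθt : ∀ y ∈ φ.target, foldPushMap s₁ s₂ s₃ β₁ β₂ θ y ∈ ψ.target) {q : X}
    (hq : q ∈ φ.source) :
    pushedMap g φ ψ s₁ s₂ s₃ β₁ β₂ θ q ∈ ψ.source ∧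
      ψ (pushedMap g φ ψ s₁ s₂ s₃ β₁ β₂ θ q) = foldPushMap s₁ s₂ s₃ β₁ β₂ θ (φ q) := by
  refine ⟨?_, ?_⟩
  · rw [pushedMap_of_mem hq]
    exact ψ.map_target (hθt (φ q) (φ.map_source hq))
  · have h := apply_pushedMap_symm (g := g) hθt (φ.map_source hq)
    rwa [φ.left_inv hq] at h

end Margin

/-! ### The main statement -/

section Main

variable {g : X → B} {φ : OpenPartialHomeomorph X (𝔼 4)} {ψ : OpenPartialHomeomorph B (𝔼 2)}
  {s₁ s₂ s₃ : ℝ} {β₁ : ContDiffBump (0 : ℝ)} {β₂ : ContDiffBump (0 : 𝔼 3)}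

/-- **The pushed map: smoothness, support, critical set, values.**  Let `g : X → B` be `C^∞`
on the Hausdorff `X`, `(φ, ψ)` smooth charts with `ψ ∘ g = F₀ ∘ φ` on `φ.source` (fold chart
of signature `(s₁, s₂, s₃)`, `sᵢ ≠ 0`), and `β₁, β₂` push bumps with box in `φ.target`.  Then
for `‖θ‖` small the pushed map `g_θ` is `C^∞`, equals `g` off `φ⁻¹(tsupport β)`, has the same
critical set as `g`, and satisfies `ψ (g_θ q) = F_θ (φ q)` on `φ.source`.
[cite: BaykurSaeki2017, §2.1 p. 6, §3] -/
theorem exists_pushedMap_spec [T2Space X] (hg : ContMDiff (𝓡 4) (𝓡 2) ∞ g)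
    (hφ : ContMDiffOn (𝓡 4) (𝓡 4) ∞ φ φ.source) (hφs : ContMDiffOn (𝓡 4) (𝓡 4) ∞ φ.symm φ.target)
    (hψ : ContMDiffOn (𝓡 2) (𝓡 2) ∞ ψ ψ.source) (hψs : ContMDiffOn (𝓡 2) (𝓡 2) ∞ ψ.symm ψ.target)
    (hmaps : MapsTo g φ.source ψ.source)
    (hid : ∀ q ∈ φ.source, ψ (g q) = foldSigMap s₁ s₂ s₃ (φ q))
    (hs₁ : s₁ ≠ 0) (hs₂ : s₂ ≠ 0) (hs₃ : s₃ ≠ 0) (hbox : box β₁ β₂ ⊆ φ.target) :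
    ∃ ε > 0, ∀ θ : 𝔼 2, ‖θ‖ < ε →
      ContMDiff (𝓡 4) (𝓡 2) ∞ (pushedMap g φ ψ s₁ s₂ s₃ β₁ β₂ θ) ∧
      (∀ q, q ∉ φ.symm '' tsupport (bump β₁ β₂) → pushedMap g φ ψ s₁ s₂ s₃ β₁ β₂ θ q = g q) ∧
      (∀ q, Surjective (mfderiv (𝓡 4) (𝓡 2) (pushedMap g φ ψ s₁ s₂ s₃ β₁ β₂ θ) q) ↔
        Surjective (mfderiv (𝓡 4) (𝓡 2) g q)) ∧
      (∀ q ∈ φ.source, pushedMap g φ ψ s₁ s₂ s₃ β₁ β₂ θ q ∈ ψ.source ∧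
        ψ (pushedMap g φ ψ s₁ s₂ s₃ β₁ β₂ θ q) = foldPushMap s₁ s₂ s₃ β₁ β₂ θ (φ q)) := by
  have hsuppt : tsupport (bump β₁ β₂) ⊆ φ.target := (tsupport_bump_subset_box β₁ β₂).trans hbox
  obtain ⟨δ, hδ, htarget⟩ := exists_push_margin hmaps hid hbox
  -- the compact modified set and the coincidence with `g` off it
  set Kc : Set X := φ.symm '' tsupport (bump β₁ β₂) with hKc
  have hKcc : IsCompact Kc := (isCompact_tsupport_bump β₁ β₂).image_of_continuousOn
    (φ.continuousOn_symm.mono hsuppt)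
  have hKcl : IsClosed Kc := hKcc.isClosed
  have heq_off : ∀ θ : 𝔼 2, ∀ q, q ∉ Kc → pushedMap g φ ψ s₁ s₂ s₃ β₁ β₂ θ q = g q := by
    intro θ q hq
    by_cases hqs : q ∈ φ.source
    · rw [pushedMap_of_mem hqs]
      have hnot : φ q ∉ tsupport (bump β₁ β₂) := fun h =>
        hq ⟨φ q, h, φ.left_inv hqs⟩
      rw [foldPushMap, image_eq_zero_of_notMem_tsupport hnot, zero_smul, add_zero, ← hid q hqs,
        ψ.left_inv (hmaps hqs)]
    · exact pushedMap_of_notMem hqs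
  -- the model representative on `φ.target`
  have hrep : ∀ θ : 𝔼 2, ‖θ‖ < δ → ∀ y ∈ φ.target,
      ψ (pushedMap g φ ψ s₁ s₂ s₃ β₁ β₂ θ (φ.symm y)) = foldPushMap s₁ s₂ s₃ β₁ β₂ θ y :=
    fun θ hθ y hy => apply_pushedMap_symm (htarget θ hθ) hy
  -- the three smallness constants
  obtain ⟨ε₁, hε₁, hcrit⟩ := exists_surjective_fderiv_foldPushMap_iff hs₁ hs₂ hs₃ β₁ β₂
  refine ⟨min δ ε₁, lt_min hδ hε₁, fun θ hθ => ?_⟩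
  have hθδ : ‖θ‖ < δ := lt_of_lt_of_le hθ (min_le_left _ _)
  have hθ₁ : ‖θ‖ < ε₁ := lt_of_lt_of_le hθ (min_le_right _ _)
  set P : X → B := pushedMap g φ ψ s₁ s₂ s₃ β₁ β₂ θ with hP
  have hFs : ContDiff ℝ ∞ (foldPushMap s₁ s₂ s₃ β₁ β₂ θ) := contDiff_foldPushMap θ
  -- smoothness on `φ.source`
  have hPon : ContMDiffOn (𝓡 4) (𝓡 2) ∞ P φ.source := by
    have h1 : ContMDiffOn (𝓡 4) (𝓡 2) ∞
        (fun q => ψ.symm (foldPushMap s₁ s₂ s₃ β₁ β₂ θ (φ q))) φ.source := by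
      refine hψs.comp ((hFs.contMDiff.comp_contMDiffOn hφ)) fun q hq => ?_
      exact htarget θ hθδ (φ q) (φ.map_source hq)
    exact h1.congr fun q hq => pushedMap_of_mem hq
  have hPmaps : MapsTo P φ.source ψ.source := fun q hq => by
    show pushedMap g φ ψ s₁ s₂ s₃ β₁ β₂ θ q ∈ ψ.source
    rw [pushedMap_of_mem hq]
    exact ψ.map_target (htarget θ hθδ (φ q) (φ.map_source hq))
  refine ⟨?_, fun q hq => heq_off θ q hq, fun q => ?_, fun q hq => ⟨hPmaps hq, ?_⟩⟩
  · -- smoothness everywhere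
    intro q
    by_cases hq : q ∈ φ.source
    · exact (hPon q hq).contMDiffAt (φ.open_source.mem_nhds hq)
    · have hqK : q ∉ Kc := fun h => by
        obtain ⟨y, hy, rfl⟩ := h
        exact hq (φ.map_target (hsuppt hy))
      have hev : P =ᶠ[𝓝 q] g :=
        eventually_of_mem (hKcl.isOpen_compl.mem_nhds hqK) fun q' hq' => heq_off θ q' hq'
      exact (hg q).congr_of_eventuallyEq hev
  · -- the critical set is unchanged
    by_cases hq : q ∈ φ.source
    · have hGf : ∀ (F : 𝔼 4 → 𝔼 2) (f : X → B), (∀ y ∈ φ.target, ψ (f (φ.symm y)) = F y) →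
          F =ᶠ[𝓝 (φ q)] (ψ ∘ f ∘ φ.symm) := fun F f h =>
        eventually_of_mem (φ.open_target.mem_nhds (φ.map_source hq)) fun y hy => (h y hy).symm
      have h1 := surjective_mfderiv_iff_of_localRepresentative hφ hφs hψ hψs hPmaps hq
        (hFs.differentiable (by simp) _) (hGf _ P (hrep θ hθδ))
      have h2 := surjective_mfderiv_iff_of_localRepresentative hφ hφs hψ hψs hmaps hq
        ((contDiff_foldSigMap s₁ s₂ s₃).differentiable (by simp) _)
        (hGf _ g fun y hy => by rw [hid _ (φ.map_target hy), φ.right_inv hy])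
      rw [h1, h2, hcrit θ hθ₁, surjective_fderiv_foldSigMap_iff hs₁ hs₂ hs₃]
    · have hqK : q ∉ Kc := fun h => by
        obtain ⟨y, hy, rfl⟩ := h
        exact hq (φ.map_target (hsuppt hy))
      have hev : P =ᶠ[𝓝 q] g :=
        eventually_of_mem (hKcl.isOpen_compl.mem_nhds hqK) fun q' hq' => heq_off θ q' hq'
      rw [hev.mfderiv_eq]
      exact Iff.rfl
  · -- values on `φ.source`
    have h := hrep θ hθδ (φ q) (φ.map_source hq)
    rwa [φ.left_inv hq] at h

end Main

end FoldPush

end Literature.Topology.FourManifolds
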